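import Mathlib
import HarnessLib

/-!
# Separability of abelian realizations of the `xyz` support (Lemma S)

Third rung of the solo-blind line (`SoloBlindAbelianRealization`, `SoloBlindDegenerationRealization`):
the structure lemma behind the exhaustive searches.  If a map `s : (Fin N → Fin 3) → H` into an abelian
group has CONSTANT sum `s a + s b + s c = u` on every support triple of `T_xyz^{⊠N}` (coordinatewise
pairwise distinct `a, b, c`) — only this direction of a realization is used — then `s` is SEPARABLE:
`s x = c₀ + ∑ i, t i (x i)` with `t i 0 = 0`.  Consequently realizations (exact or degenerate) of
`T_xyz^{⊠N}` in `H` are parametrised by `2N` group elements `pᵢ = t i 1`, `qᵢ = t i 2`, which is what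
makes the minimal realizing order a finite lattice problem (solo-blind notes, Lemma S / Corollary L2).

Proof: slice along the last coordinate, `s_c(x') = s(x', c)`.  For coordinatewise-distinct `x', y'`
choose `a'` distinct from both in every coordinate; comparing the support triples
`((a',0),(x',1),(y',2))` and `((a',0),(y',1),(x',2))` gives `(s₁ - s₂)(x') = (s₁ - s₂)(y')`, and any two
points have a common coordinatewise-distinct neighbour, so `s₁ - s₂` (likewise `s₀ - s₁`) is constant;
then induct on `N` with `s₀`.
-/

open scoped BigOperators

namespace Summit.MatrixMultiplication.MatrixMultiplication.Theorems

set_option linter.dupNamespace false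

/- A value of `Fin 3` different from two given ones (table lookup; local notation, no new definition). -/
set_option quotPrecheck false in
local notation "otherFin3" =>
  (fun v w : Fin 3 => (![![1, 2, 1], ![2, 2, 0], ![1, 0, 0]] : Fin 3 → Fin 3 → Fin 3) v w)

/-- `otherFin3 v w ∉ {v, w}`. [new] -/
theorem otherFin3_ne (v w : Fin 3) : v ≠ otherFin3 v w ∧ otherFin3 v w ≠ w := by
  revert v w
  decide

/-- Appending last coordinates `0, 1, 2` (in some order without repetition) to a coordinatewise-distinct
triple keeps it coordinatewise distinct. [new] -/
theorem snoc_support {N : ℕ} {a b c : Fin N → Fin 3} (h : ∀ i, a i ≠ b i ∧ b i ≠ c i ∧ a i ≠ c i)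
    {x y z : Fin 3} (hxyz : x ≠ y ∧ y ≠ z ∧ x ≠ z) :
    ∀ i : Fin (N + 1), (Fin.snoc a x : Fin (N + 1) → Fin 3) i ≠ (Fin.snoc b y : Fin (N + 1) → Fin 3) i ∧
      (Fin.snoc b y : Fin (N + 1) → Fin 3) i ≠ (Fin.snoc c z : Fin (N + 1) → Fin 3) i ∧
      (Fin.snoc a x : Fin (N + 1) → Fin 3) i ≠ (Fin.snoc c z : Fin (N + 1) → Fin 3) i := by
  intro i
  induction i using Fin.lastCases with
  | last => simpa using hxyz
  | cast j => simpa using h j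

/-- **Lemma S (separability).** A map with constant sum on the support of `T_xyz^{⊠N}` is a sum of
one-coordinate maps. [new] -/
theorem separable_of_sum_const_on_support {H : Type*} [AddCommGroup H] :
    ∀ (N : ℕ) (s : (Fin N → Fin 3) → H) (u : H),
      (∀ a b c : Fin N → Fin 3, (∀ i, a i ≠ b i ∧ b i ≠ c i ∧ a i ≠ c i) → s a + s b + s c = u) →
      ∃ (c₀ : H) (t : Fin N → Fin 3 → H), (∀ i, t i 0 = 0) ∧ ∀ x, s x = c₀ + ∑ i, t i (x i)
  | 0, s, u, _ => by
    refine ⟨s Fin.elim0, fun i => Fin.elim0 i, fun i => Fin.elim0 i, fun x => ?_⟩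
    rw [Finset.univ_eq_empty, Finset.sum_empty, add_zero, Subsingleton.elim x Fin.elim0]
  | N + 1, s, u, h => by
    -- slices along the last coordinate
    set sl : Fin 3 → (Fin N → Fin 3) → H := fun c x' => s (Fin.snoc x' c) with hsl
    -- (1) differences of slices are constant
    have key12 : ∀ x' y' : Fin N → Fin 3, (∀ i, x' i ≠ y' i) →
        sl 1 x' - sl 2 x' = sl 1 y' - sl 2 y' := by
      intro x' y' hxy
      set a' : Fin N → Fin 3 := fun i => otherFin3 (x' i) (y' i)
      have ha : ∀ i, a' i ≠ x' i ∧ x' i ≠ y' i ∧ a' i ≠ y' i := fun i =>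
        ⟨(otherFin3_ne _ _).1.symm, hxy i, (otherFin3_ne _ _).2⟩
      have ha' : ∀ i, a' i ≠ y' i ∧ y' i ≠ x' i ∧ a' i ≠ x' i := fun i =>
        ⟨(otherFin3_ne _ _).2, (hxy i).symm, (otherFin3_ne _ _).1.symm⟩
      have e1 := h _ _ _ (snoc_support ha (x := 0) (y := 1) (z := 2) (by decide))
      have e2 := h _ _ _ (snoc_support ha' (x := 0) (y := 1) (z := 2) (by decide))
      rw [sub_eq_sub_iff_add_eq_add]
      have := e1.trans e2.symm
      -- s(a',0) + s(x',1) + s(y',2) = s(a',0) + s(y',1) + s(x',2)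
      have h3 : sl 1 x' + sl 2 y' = sl 1 y' + sl 2 x' := by
        have := add_left_cancel (add_assoc (sl 0 a') (sl 1 x') (sl 2 y') ▸
          add_assoc (sl 0 a') (sl 1 y') (sl 2 x') ▸ this)
        exact this
      exact h3
    have key01 : ∀ x' y' : Fin N → Fin 3, (∀ i, x' i ≠ y' i) →
        sl 0 x' - sl 1 x' = sl 0 y' - sl 1 y' := by
      intro x' y' hxy
      set a' : Fin N → Fin 3 := fun i => otherFin3 (x' i) (y' i)
      have ha : ∀ i, x' i ≠ y' i ∧ y' i ≠ a' i ∧ x' i ≠ a' i := fun i =>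
        ⟨hxy i, (otherFin3_ne _ _).2.symm, (otherFin3_ne _ _).1⟩
      have ha' : ∀ i, y' i ≠ x' i ∧ x' i ≠ a' i ∧ y' i ≠ a' i := fun i =>
        ⟨(hxy i).symm, (otherFin3_ne _ _).1, (otherFin3_ne _ _).2.symm⟩
      have e1 := h _ _ _ (snoc_support ha (x := 0) (y := 1) (z := 2) (by decide))
      have e2 := h _ _ _ (snoc_support ha' (x := 0) (y := 1) (z := 2) (by decide))
      rw [sub_eq_sub_iff_add_eq_add]
      -- s(x',0) + s(y',1) + s(a',2) = s(y',0) + s(x',1) + s(a',2)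
      have := add_right_cancel (e1.trans e2.symm)
      -- this : sl 0 x' + sl 1 y' = sl 0 y' + sl 1 x'
      exact this
    -- (2) any two points have a common coordinatewise-distinct neighbour, so the differences are constant
    have const12 : ∀ x' : Fin N → Fin 3, sl 1 x' - sl 2 x' = sl 1 (fun _ => 0) - sl 2 (fun _ => 0) := by
      intro x'
      set y' : Fin N → Fin 3 := fun i => otherFin3 (x' i) 0
      rw [key12 x' y' fun i => (otherFin3_ne _ _).1, key12 (fun _ => 0) y' fun i => (otherFin3_ne _ _).2.symm]
    have const01 : ∀ x' : Fin N → Fin 3, sl 0 x' - sl 1 x' = sl 0 (fun _ => 0) - sl 1 (fun _ => 0) := by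
      intro x'
      set y' : Fin N → Fin 3 := fun i => otherFin3 (x' i) 0
      rw [key01 x' y' fun i => (otherFin3_ne _ _).1, key01 (fun _ => 0) y' fun i => (otherFin3_ne _ _).2.symm]
    set D01 := sl 0 (fun _ => 0) - sl 1 (fun _ => 0) with hD01
    set D12 := sl 1 (fun _ => 0) - sl 2 (fun _ => 0) with hD12
    -- the last-coordinate contribution
    set τ : Fin 3 → H := ![0, -D01, -(D01 + D12)] with hτ
    have slice_eq : ∀ (c : Fin 3) (x' : Fin N → Fin 3), sl c x' = sl 0 x' + τ c := by
      intro c x'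
      have h01 := const01 x'
      have h12 := const12 x'
      fin_cases c
      · show sl 0 x' = sl 0 x' + τ 0
        simp [hτ]
      · show sl 1 x' = sl 0 x' + τ 1
        have e : τ 1 = -D01 := by simp [hτ]
        rw [e, ← h01]
        abel
      · show sl 2 x' = sl 0 x' + τ 2
        have e : τ 2 = -(D01 + D12) := by
          simp only [hτ]
          rfl
        rw [e, ← h01, ← h12]
        abel
    -- (3) induction hypothesis for the slice `sl 0`
    have h0 : ∀ a b c : Fin N → Fin 3, (∀ i, a i ≠ b i ∧ b i ≠ c i ∧ a i ≠ c i) →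
        sl 0 a + sl 0 b + sl 0 c = u - τ 1 - τ 2 := by
      intro a b c habc
      have e := h _ _ _ (snoc_support habc (x := 0) (y := 1) (z := 2) (by decide))
      -- e : s (snoc a 0) + s (snoc b 1) + s (snoc c 2) = u
      have e' : sl 0 a + sl 1 b + sl 2 c = u := e
      rw [slice_eq 1 b, slice_eq 2 c] at e'
      rw [← e']; abel
    obtain ⟨c₀, t', ht'0, ht'⟩ := separable_of_sum_const_on_support N (sl 0) _ h0
    refine ⟨c₀, Fin.snoc t' τ, ?_, ?_⟩
    · intro i
      induction i using Fin.lastCases with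
      | last => simp [hτ]
      | cast j => simpa using ht'0 j
    · intro x
      have hx : x = Fin.snoc (Fin.init x) (x (Fin.last N)) := (Fin.snoc_init_self x).symm
      rw [hx]
      change sl (x (Fin.last N)) (Fin.init x) = _
      rw [slice_eq, ht', Fin.sum_univ_castSucc]
      simp only [Fin.snoc_castSucc, Fin.snoc_last, Fin.init]
      abel

/-- **Parametrisation.** Under the same hypothesis, `s x = c₀ + ∑ i, (0, pᵢ, qᵢ)[x i]` for some
`c₀` and `p q : Fin N → H` — the `2N` group elements searched over in the solo-blind computations. [new] -/
theorem exists_params_of_sum_const_on_support {H : Type*} [AddCommGroup H] {N : ℕ}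
    (s : (Fin N → Fin 3) → H) (u : H)
    (h : ∀ a b c : Fin N → Fin 3, (∀ i, a i ≠ b i ∧ b i ≠ c i ∧ a i ≠ c i) → s a + s b + s c = u) :
    ∃ (c₀ : H) (p q : Fin N → H), ∀ x, s x = c₀ + ∑ i, (![0, p i, q i] : Fin 3 → H) (x i) := by
  obtain ⟨c₀, t, ht0, ht⟩ := separable_of_sum_const_on_support N s u h
  refine ⟨c₀, fun i => t i 1, fun i => t i 2, fun x => ?_⟩
  rw [ht x]
  congr 1
  refine Finset.sum_congr rfl fun i _ => ?_
  have : ∀ v : Fin 3, t i v = (![0, t i 1, t i 2] : Fin 3 → H) v := by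
    intro v
    fin_cases v
    · simpa using ht0 i
    · simp
    · simp
  exact this (x i)

end Summit.MatrixMultiplication.MatrixMultiplication.Theorems
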